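import Mathlib
import Summits.Schanuel.Schanuel.Theses.RoyCriterion
import Literature.NumberTheory.Transcendental.RoyCriterionProofs
import Literature.NumberTheory.Transcendental.RoyCriterionProp3Proofs

/-!
# Sketch (crux-ideate k=2, round 1) — crux stmt-Schanuel-0078 `RoyThesis := ∀ n, RoyCriterion n`

Card `gift-exponent-window`: the free auxiliary polynomials ("gifts") for the pair `(z, e^z)` and the
ENLARGED-WINDOW form of Roy's criterion.  Everything here elaborates; the two FIRST LEMMAS are stated
as `Prop`s (`GiftFeedsHypothesis`, `EnlargedWindowEquivalence`); the composition down to the crux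
decl is PROVED (`royThesis_of_enlarged`), as is the Dirichlet side of the gift (`gift_of_admissible`,
from the tree's `exists_royAuxPoly`) and the vacuity lemma (`royHypothesis_exp_all`, = tree
`royHypothesis_exp'`).
-/

noncomputable section

open Filter Complex MvPolynomial
open Literature.NumberTheory.Transcendental

namespace Summit.Schanuel.Schanuel.Cruxes.roy_thesis.Sketch2

/-- GIFT at exponent `u`: for every `c ≥ 0` and every large `N` there is `0 ≠ P ∈ ℤ[X₀,X₁]` of
bidegree `≤ (N^{t₀}, N^{t₁})`, height `≤ e^N`, with `sup_{|z| ≤ 1 + cN^{s₁}} |P(z, e^z)| ≤ e^{-2N^u}`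
(Roy 2002 Cor. 8.5 (i) gives this for `max{1,t₀,s₁+t₁} < u < (1+t₀+t₁)/2`; Cor. 8.5 (ii) forbids it for
`u > max{s₁+t₁, t₀+t₁}`). -/
def Gift (t₀ t₁ s₁ u : ℝ) : Prop :=
  ∀ c : ℝ, 0 ≤ c → ∀ᶠ N : ℕ in atTop, ∃ P : MvPolynomial (Fin 2) ℤ, P ≠ 0 ∧
    (P.degreeOf 0 : ℝ) ≤ (N : ℝ) ^ t₀ ∧ (P.degreeOf 1 : ℝ) ≤ (N : ℝ) ^ t₁ ∧
    (mvPolyHeight P : ℝ) ≤ Real.exp N ∧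
    ∀ z : ℂ, ‖z‖ ≤ 1 + c * (N : ℝ) ^ s₁ → ‖aeval ![z, cexp z] P‖ ≤ Real.exp (-(2 * (N : ℝ) ^ u))

/-- The gift exponent `u*(t₀,t₁,s₁) = sup {u : Gift t₀ t₁ s₁ u}` ∈ [(1+t₀+t₁)/2, t₀+t₁]
(Roy2002 Cor. 8.5; the upper bracket is Tijdeman's and ignores integrality). -/
def giftExponent (t₀ t₁ s₁ : ℝ) : ℝ := sSup {u : ℝ | Gift t₀ t₁ s₁ u}

/-- `GiftBeyondDirichlet`: the integer lattice is ALIGNED with the thin body — gifts exist strictly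
above Waldschmidt's exponent.  The card's load-bearing bet (planner's own expectation: false). -/
def GiftBeyondDirichlet (t₀ t₁ s₁ : ℝ) : Prop := ∃ u : ℝ, (1 + t₀ + t₁) / 2 < u ∧ Gift t₀ t₁ s₁ u

/-- `GiftSharp`: Waldschmidt's construction is Dirichlet-optimal for `(z, e^z)` — the cheapest
falsifier of the card (closes the gap left open in Roy2002 Cor. 8.5 for `𝔾ₐ×𝔾ₘ`; the `𝔾ₘ²`
analogue is Roy2002 (V)). -/
def GiftSharp (t₀ t₁ s₁ : ℝ) : Prop := ∀ u : ℝ, (1 + t₀ + t₁) / 2 < u → ¬ Gift t₀ t₁ s₁ u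

/-- Roy's Conjecture 2 at ONE parameter tuple (no admissibility clause). -/
def RoyCriterionAt (l : ℕ) (s₀ s₁ t₀ t₁ u : ℝ) : Prop :=
  ∀ (y α : Fin l → ℂ), LinearIndependent ℚ y → (∀ j, α j ≠ 0) →
    RoyHypothesis y α s₀ s₁ t₀ t₁ u →
      (l : Cardinal) ≤ Algebra.trdeg ℚ ↥(IntermediateField.adjoin ℚ (Set.range y ∪ Set.range α))

/-- Lower window: Roy's (1) WITHOUT the upper bound `u < (1+t₀+t₁)/2` (exactly what Prop. 3 =
Thm 1 (b)⇒(a) uses: `max{1,t₀,2t₁} < min{s₀,2s₁}`, `min{s₀,2s₁} < u`; plus `max{s₀,s₁+t₁} < u` for the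
Cauchy/`k!` bookkeeping of §5 2°). -/
def LowerWindow (s₀ s₁ t₀ t₁ u : ℝ) : Prop :=
  0 < s₀ ∧ 0 < s₁ ∧ 0 < t₀ ∧ 0 < t₁ ∧ 0 < u ∧
    max 1 (max t₀ (2 * t₁)) < min s₀ (2 * s₁) ∧ max s₀ (s₁ + t₁) < u

/-- FIRST LEMMA (A1, "gift universality"): a gift at exponent `u` feeds Roy's hypothesis at
`α = e^y` for EVERY `y` (linearly independent or not, any transcendence degree) once `s₀ < u`.
Proof = the tree's `royHypothesis_exp'` with `exists_royAuxPoly` replaced by the hypothesis `Gift`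
(Cauchy on the unit circle around `Σ mⱼyⱼ`, `k! e^{-2N^u} ≤ e^{-N^u}` for `k ≤ N^{s₀}`, `s₀ < u`). -/
def GiftFeedsHypothesis : Prop :=
  ∀ (s₀ s₁ t₀ t₁ u : ℝ), 0 < s₀ → s₀ < u → Gift t₀ t₁ s₁ u →
    ∀ (l : ℕ) (y : Fin l → ℂ), RoyHypothesis y (cexp ∘ y) s₀ s₁ t₀ t₁ u

/-- FIRST LEMMA (A2, "enlarged-window equivalence"): on the lower window, at any exponent `u`
carrying a gift, Roy's criterion at that single tuple is equivalent to Schanuel in the same rank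
(`→`: A1 + `RoyCriterionAt`; `←`: tree `Roy2001_prop3_holds` ⇒ `αⱼ = ζⱼe^{yⱼ}` ⇒ same field as
`ℚ(y, e^y)` up to algebraic elements). Roy's printed window is the case `u < (1+t₀+t₁)/2`. -/
def EnlargedWindowEquivalence : Prop :=
  ∀ (l : ℕ) (s₀ s₁ t₀ t₁ u : ℝ), LowerWindow s₀ s₁ t₀ t₁ u → Gift t₀ t₁ s₁ u →
    (RoyCriterionAt l s₀ s₁ t₀ t₁ u ↔ SchanuelRank l)

/-- TRANSFER `C(u)`: Roy's Conjecture 2 at some tuple of the lower window whose exponent `u`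
carries a gift — formally WEAKER than the crux whenever `u > (1+t₀+t₁)/2` (stronger hypothesis). -/
def RoyThesisEnlarged : Prop :=
  ∀ l : ℕ, ∃ s₀ s₁ t₀ t₁ u : ℝ, LowerWindow s₀ s₁ t₀ t₁ u ∧ Gift t₀ t₁ s₁ u ∧
    RoyCriterionAt l s₀ s₁ t₀ t₁ u

/-- Composition down to the crux decl (kernel-checked glue): A2 + C(u) ⇒ `RoyThesis`. -/
theorem royThesis_of_enlarged (hE : EnlargedWindowEquivalence) (hC : RoyThesisEnlarged) :
    Summit.Schanuel.Schanuel.Theses.RoyCriterion.RoyThesis := by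
  intro n
  obtain ⟨s₀, s₁, t₀, t₁, u, hW, hG, hAt⟩ := hC n
  exact (Roy2001_iff_holds n).mpr ((hE n s₀ s₁ t₀ t₁ u hW hG).mp hAt)

/-- Dirichlet side of the gift (Roy2002 Cor. 8.5 (i); tree `exists_royAuxPoly`): every admissible
tuple carries a gift at its own `u`. -/
theorem gift_of_admissible {s₀ s₁ t₀ t₁ u : ℝ} (h : RoyAdmissible s₀ s₁ t₀ t₁ u) :
    Gift t₀ t₁ s₁ u := by
  intro c hc
  simpa only [expEval_apply] using exists_royAuxPoly h hc

/-- Vacuity lemma (tree `royHypothesis_exp'`): in Roy's printed window the hypothesis of the crux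
holds at `α = e^y` for EVERY `y` — so no line may extract information about `y` from it. -/
theorem royHypothesis_exp_all {l : ℕ} (y : Fin l → ℂ) {s₀ s₁ t₀ t₁ u : ℝ}
    (h : RoyAdmissible s₀ s₁ t₀ t₁ u) : RoyHypothesis y (cexp ∘ y) s₀ s₁ t₀ t₁ u :=
  royHypothesis_exp' y h

/-- The crux restricted to `α = e^y` is literally Schanuel (both directions bookkeeping). -/
theorem royCriterionAt_exp_iff_of (hE : EnlargedWindowEquivalence) {l : ℕ} {s₀ s₁ t₀ t₁ u : ℝ}
    (hW : LowerWindow s₀ s₁ t₀ t₁ u) (hG : Gift t₀ t₁ s₁ u) :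
    RoyCriterionAt l s₀ s₁ t₀ t₁ u ↔ SchanuelRank l :=
  hE l s₀ s₁ t₀ t₁ u hW hG

end Summit.Schanuel.Schanuel.Cruxes.roy_thesis.Sketch2

end
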